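import Mathlib
import HarnessLib
import Summits.Ventures.LatticeQCDFlow.Scoring.GlivenkoCantelliRate

/-!
# The three HOEFFDING EVENTS behind a finite-sample band for the REWEIGHTED empirical
# distribution function under a weight CEILING `p/q ≤ M`: the total weight stays above `n/2`,
# and at a point the centred weighted counts (for `≤` and for `<`) stay below `nδ/2`,
# except with probabilities `e^{−n/(2M²)}` and `e^{−nδ²/(8M²)}`

HONEST FRAMING: exact (Metropolis-corrected) sampling algorithms for lattice gauge theory;
figures of merit are autocorrelation/cost numbers at stated couplings and volumes; no
continuum-physics claim.

Venture `LatticeQCDFlow` (cell pub-lqcd), topic `Scoring`; FANOUT row 4 (`s0-u1-b`, rung S0-B).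
`Scoring/GlivenkoCantelli.reweightedGlivenkoCantelli_ae` proved that the printed reweighted
empirical distribution function `F̂ₙ(t) = Σ_{i<n} w̃ᵢ1{O(yᵢ) ≤ t}/Σ_{i<n} w̃ᵢ` of a statistic
`O` along one proposal stream converges uniformly to `F = cdf ρ`, `ρ = (p dμ)∘O⁻¹`, with no
rate; `Scoring/GlivenkoCantelliRate` gave the rate for equal weights.  This file gives the
finite-`n` band for the reweighted function under a weight CEILING `p/q ≤ M` (the cell's
"ceiling" regime; the printed normalisation `w̃ = c·p/q`, `c > 0`, is immaterial —
**`reweightedEDF_scale_free`**).  Three Hoeffding events (Literature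
`measureReal_le_sum_le_exp_of_integral_le`): the total weight stays above `n/2`
(**`measureReal_weightSum_le_half_le`**, summands `−w ∈ [−M, 0]`, mean `−1`), and at each grid
point the centred weighted sums `Σ wᵢ(F(q) − 1{Oᵢ ≤ q})`, `Σ wᵢ(1{Oᵢ < q} − F(q−))`
(summands in `[−M, M]`, mean `0`) stay below `nδ/2`
(**`measureReal_weightedLowerDev_ge_le`**, **`measureReal_weightedUpperDev_ge_le`**); on the
complement the one-function sandwich `abs_cdf_sub_lt_of_grid` bounds every deviation by
`δ + 1/K` — that assembly is the sequel `Scoring/ReweightedEDFBand`; THIS FILE proves the three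
Hoeffding events and the two expectations behind them.  NEW WORK of the cell; no definition;
nothing cited as a fact.

## Content

* `reweightedEDF_scale_free`; `integral_weight_stream`, `integral_weight_indicator_stream`;
* `measureReal_weightSum_le_half_le`, `measureReal_weightedLowerDev_ge_le`,
  `measureReal_weightedUpperDev_ge_le` — the three Hoeffding events (this file);
* the band itself is assembled in the sequel `Scoring/ReweightedEDFBand`.

NOT CLAIMED: the ceiling-free regime (unbounded `p/q`: no exponential band without moment
assumptions); an `ε`-form with optimised constants; dependent (Markov-chain) proposals.
-/

noncomputable section

namespace Summit.Ventures.LatticeQCDFlow.Scoring.GlivenkoCantelli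

open MeasureTheory ProbabilityTheory Finset Filter Function
open scoped Topology

variable {Ω : Type*} [MeasurableSpace Ω] {P : Measure Ω} [IsProbabilityMeasure P]
variable {X : Type*} [MeasurableSpace X] {μ : Measure X} {p q O : X → ℝ} {y : ℕ → Ω → X}

/-! ## §1 Scale-freeness and the two expectations -/

section Expectations

omit [MeasurableSpace Ω] [IsProbabilityMeasure P] [MeasurableSpace X] in
/-- The reweighted empirical distribution function does not see the normalisation of the printed
weights: `Σ c·wᵢ·gᵢ / Σ c·wᵢ = Σ wᵢgᵢ / Σ wᵢ` for `c ≠ 0`. [ours] -/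
theorem reweightedEDF_scale_free {wt : X → ℝ} {c : ℝ} (hc : c ≠ 0)
    (hwt : ∀ z, wt z = c * (p z / q z)) (g : X → ℝ) (n : ℕ) (ω : Ω) :
    (∑ i ∈ range n, wt (y i ω) * g (y i ω)) / (∑ i ∈ range n, wt (y i ω))
      = (∑ i ∈ range n, p (y i ω) / q (y i ω) * g (y i ω))
        / (∑ i ∈ range n, p (y i ω) / q (y i ω)) := by
  simp_rw [hwt, mul_assoc, ← Finset.mul_sum]
  rw [mul_div_mul_left _ _ hc]

omit [IsProbabilityMeasure P] in
/-- `E[w(yᵢ)] = ∫ p dμ = 1` for `w = p/q`, one draw of the stream. [ours] -/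
theorem integral_weight_stream (hym : ∀ j, Measurable (y j))
    (hlaw : ∀ j, Measure.map (y j) P = μ.withDensity fun z => ENNReal.ofReal (q z))
    (hpm : Measurable p) (hp1 : ∫ z, p z ∂μ = 1) (hq0 : ∀ z, 0 < q z) (hqm : Measurable q)
    (i : ℕ) : ∫ ω, p (y i ω) / q (y i ω) ∂P = 1 := by
  have hwm : Measurable fun z => p z / q z := hpm.div hqm
  rw [CardConsistency.integral_comp_stream hym hlaw hwm i,
    AllPairsVariance.integral_withDensity_eq' (fun z => (hq0 z).le) hqm]
  have e : (fun z => p z / q z * q z) = p := funext fun z => div_mul_cancel₀ _ (hq0 z).ne'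
  rw [e, hp1]

omit [IsProbabilityMeasure P] in
/-- `E[w(yᵢ)·1{O(yᵢ) ∈ I}] = ρ(I)`, `ρ = (p dμ)∘O⁻¹`, for a measurable `I ⊆ ℝ`. [ours] -/
theorem integral_weight_indicator_stream (hym : ∀ j, Measurable (y j))
    (hlaw : ∀ j, Measure.map (y j) P = μ.withDensity fun z => ENNReal.ofReal (q z))
    (hp0 : ∀ z, 0 ≤ p z) (hpm : Measurable p) (hq0 : ∀ z, 0 < q z) (hqm : Measurable q)
    (hOm : Measurable O) {I : Set ℝ} (hI : MeasurableSet I) (i : ℕ) :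
    ∫ ω, p (y i ω) / q (y i ω) * I.indicator (1 : ℝ → ℝ) (O (y i ω)) ∂P
      = ((μ.withDensity fun z => ENNReal.ofReal (p z)).map O).real I := by
  have hgm : Measurable fun z => p z / q z * I.indicator (1 : ℝ → ℝ) (O z) :=
    (hpm.div hqm).mul ((measurable_one.indicator hI).comp hOm)
  rw [CardConsistency.integral_comp_stream hym hlaw hgm i,
    AllPairsVariance.integral_withDensity_eq' (fun z => (hq0 z).le) hqm,
    ← integral_target_indicator_eq hp0 hpm hOm hI]
  refine integral_congr_ae (Eventually.of_forall fun z => ?_)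
  have hqz : q z ≠ 0 := (hq0 z).ne'
  field_simp

end Expectations

/-! ## §2 Three Hoeffding events -/

section Hoeffding

/-- **The total weight rarely drops below half its mean**: `w = p/q ∈ [0, M]`, `E w = 1`,
`n ≥ 1` ⇒ `P(Σ_{i<n} w(yᵢ) ≤ n/2) ≤ e^{−n/(2M²)}`. [ours] (Hoeffding for `−wᵢ ∈ [−M, 0]`) -/
theorem measureReal_weightSum_le_half_le (hym : ∀ j, Measurable (y j)) (hind : iIndepFun y P)
    (hlaw : ∀ j, Measure.map (y j) P = μ.withDensity fun z => ENNReal.ofReal (q z))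
    (hp0 : ∀ z, 0 ≤ p z) (hpm : Measurable p) (hp1 : ∫ z, p z ∂μ = 1) (hq0 : ∀ z, 0 < q z)
    (hqm : Measurable q) {M : ℝ} (hM0 : 0 < M) (hM : ∀ z, p z / q z ≤ M) (n : ℕ) :
    P.real {ω | ∑ i ∈ range n, p (y i ω) / q (y i ω) ≤ n / 2}
      ≤ Real.exp (-(n / (2 * M ^ 2))) := by
  have hwm : Measurable fun z => p z / q z := hpm.div hqm
  set W : ℕ → Ω → ℝ := fun i ω => -(p (y i ω) / q (y i ω)) with hW
  have hWm : ∀ i, AEMeasurable (W i) P := fun i => ((hwm.comp (hym i)).neg).aemeasurable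
  have hWind : iIndepFun W P := hind.comp (fun _ z => -(p z / q z)) fun _ => hwm.neg
  have hWb : ∀ i, ∀ᵐ ω ∂P, W i ω ∈ Set.Icc (-M) 0 := fun i => ae_of_all _ fun ω =>
    ⟨neg_le_neg (hM _), neg_nonpos.2 (div_nonneg (hp0 _) (hq0 _).le)⟩
  have hWmean : ∀ i, ∫ ω, W i ω ∂P ≤ -1 := by
    intro i
    rw [hW]
    simp only []
    rw [integral_neg, integral_weight_stream hym hlaw hpm hp1 hq0 hqm i]
  have hH := Literature.Probability.Moments.measureReal_le_sum_le_exp_of_integral_le hWind hWm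
    hWb hWmean (δ := 1 / 2) (by norm_num) (range n)
  rw [Finset.card_range] at hH
  have hsub : {ω | ∑ i ∈ range n, p (y i ω) / q (y i ω) ≤ n / 2}
      ⊆ {ω | (n : ℝ) * (-1 + 1 / 2) ≤ ∑ i ∈ range n, W i ω} := by
    intro ω hω
    simp only [Set.mem_setOf_eq, hW, Finset.sum_neg_distrib] at hω ⊢
    linarith
  refine (measureReal_mono hsub).trans (hH.trans (le_of_eq ?_))
  have hMne : M ≠ 0 := hM0.ne'
  rw [show (0 : ℝ) - -M = M by ring]
  congr 1
  rw [neg_inj, div_eq_div_iff (pow_ne_zero 2 hMne) (mul_ne_zero two_ne_zero (pow_ne_zero 2 hMne))]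
  ring

/-- **Lower deviation of the weighted counts at a point**: `w ∈ [0, M]`, `F = cdf ρ`, `δ ≥ 0` ⇒
`P(nδ/2 ≤ Σ_{i<n} w(yᵢ)(F(u) − 1{O(yᵢ) ≤ u})) ≤ e^{−nδ²/(8M²)}`. [ours] (Hoeffding, summands in
`[−M, M]` with mean `F(u)·1 − ρ(−∞, u] = 0`) -/
theorem measureReal_weightedLowerDev_ge_le (hym : ∀ j, Measurable (y j)) (hind : iIndepFun y P)
    (hlaw : ∀ j, Measure.map (y j) P = μ.withDensity fun z => ENNReal.ofReal (q z))
    (hp0 : ∀ z, 0 ≤ p z) (hpm : Measurable p) (hpi : Integrable p μ) (hp1 : ∫ z, p z ∂μ = 1)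
    (hq0 : ∀ z, 0 < q z) (hqm : Measurable q) (hOm : Measurable O) {M : ℝ} (hM0 : 0 < M)
    (hM : ∀ z, p z / q z ≤ M) (u : ℝ) {δ : ℝ} (hδ : 0 ≤ δ) (n : ℕ) :
    P.real {ω | (n : ℝ) * δ / 2 ≤ ∑ i ∈ range n, p (y i ω) / q (y i ω)
        * (cdf ((μ.withDensity fun z => ENNReal.ofReal (p z)).map O) u
          - (Set.Iic u).indicator (1 : ℝ → ℝ) (O (y i ω)))}
      ≤ Real.exp (-(n * δ ^ 2 / (8 * M ^ 2))) := by
  haveI := isProbabilityMeasure_targetLaw (μ := μ) hp0 hpi hp1 hOm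
  set F : ℝ := cdf ((μ.withDensity fun z => ENNReal.ofReal (p z)).map O) u with hF
  have hF0 : 0 ≤ F := cdf_nonneg _ u
  have hF1 : F ≤ 1 := cdf_le_one _ u
  have hwm : Measurable fun z => p z / q z := hpm.div hqm
  have hgm : Measurable fun z => p z / q z * (F - (Set.Iic u).indicator (1 : ℝ → ℝ) (O z)) :=
    hwm.mul (measurable_const.sub ((measurable_one.indicator measurableSet_Iic).comp hOm))
  set W : ℕ → Ω → ℝ := fun i ω =>
    p (y i ω) / q (y i ω) * (F - (Set.Iic u).indicator (1 : ℝ → ℝ) (O (y i ω))) with hW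
  have hWm : ∀ i, AEMeasurable (W i) P := fun i => (hgm.comp (hym i)).aemeasurable
  have hWind : iIndepFun W P :=
    hind.comp (fun _ z => p z / q z * (F - (Set.Iic u).indicator (1 : ℝ → ℝ) (O z))) fun _ => hgm
  have hWb : ∀ i, ∀ᵐ ω ∂P, W i ω ∈ Set.Icc (-M) M := fun i => ae_of_all _ fun ω => by
    have hw0 : 0 ≤ p (y i ω) / q (y i ω) := div_nonneg (hp0 _) (hq0 _).le
    have hwM := hM (y i ω)
    have hf1 : F - (Set.Iic u).indicator (1 : ℝ → ℝ) (O (y i ω)) ≤ 1 := by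
      linarith [indicator_one_nonneg (Set.Iic u) (O (y i ω))]
    have hf0 : -1 ≤ F - (Set.Iic u).indicator (1 : ℝ → ℝ) (O (y i ω)) := by
      linarith [indicator_one_le_one (Set.Iic u) (O (y i ω))]
    constructor
    · simp only [hW]
      nlinarith
    · simp only [hW]
      nlinarith
  have hWmean : ∀ i, ∫ ω, W i ω ∂P ≤ 0 := by
    intro i
    have e : ∫ ω, W i ω ∂P = F * ∫ ω, p (y i ω) / q (y i ω) ∂P
        - ∫ ω, p (y i ω) / q (y i ω) * (Set.Iic u).indicator (1 : ℝ → ℝ) (O (y i ω)) ∂P := by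
      rw [hW]
      simp only [mul_sub]
      rw [integral_sub, ← integral_const_mul]
      · congr 1
        refine integral_congr_ae (Eventually.of_forall fun ω => ?_)
        ring
      · exact ((CardConsistency.integrable_comp_stream_iff hym hlaw hwm i).2
          ((AllPairsVariance.integrable_withDensity_iff' (fun z => (hq0 z).le) hqm _).2
            (by simpa only [div_mul_cancel₀ _ (hq0 _).ne'] using hpi))).mul_const F
      · refine Integrable.mono' (((CardConsistency.integrable_comp_stream_iff hym hlaw hwm i).2
          ((AllPairsVariance.integrable_withDensity_iff' (fun z => (hq0 z).le) hqm _).2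
            (by simpa only [div_mul_cancel₀ _ (hq0 _).ne'] using hpi))).norm)
          ((hwm.mul ((measurable_one.indicator measurableSet_Iic).comp hOm)).comp
            (hym i)).aestronglyMeasurable (Eventually.of_forall fun ω => ?_)
        rw [Real.norm_eq_abs, Real.norm_eq_abs, abs_mul]
        refine mul_le_of_le_one_right (abs_nonneg _) ?_
        rw [abs_of_nonneg (indicator_one_nonneg _ _)]
        exact indicator_one_le_one _ _
    rw [e, integral_weight_stream hym hlaw hpm hp1 hq0 hqm i,
      integral_weight_indicator_stream hym hlaw hp0 hpm hq0 hqm hOm measurableSet_Iic i, hF,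
      cdf_eq_real, mul_one, sub_self]
  have hH := Literature.Probability.Moments.measureReal_le_sum_le_exp_of_integral_le hWind hWm
    hWb hWmean (δ := δ / 2) (by positivity) (range n)
  rw [Finset.card_range] at hH
  have hsub : {ω | (n : ℝ) * δ / 2 ≤ ∑ i ∈ range n, p (y i ω) / q (y i ω)
        * (F - (Set.Iic u).indicator (1 : ℝ → ℝ) (O (y i ω)))}
      ⊆ {ω | (n : ℝ) * (0 + δ / 2) ≤ ∑ i ∈ range n, W i ω} := by
    intro ω hω
    simp only [Set.mem_setOf_eq, hW] at hω ⊢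
    linarith
  refine (measureReal_mono hsub).trans (hH.trans (le_of_eq ?_))
  congr 1
  field_simp
  ring

/-- **Upper deviation of the strict weighted counts at a point**: `δ ≥ 0` ⇒
`P(nδ/2 ≤ Σ_{i<n} w(yᵢ)(1{O(yᵢ) < u} − F(u−))) ≤ e^{−nδ²/(8M²)}`. [ours] -/
theorem measureReal_weightedUpperDev_ge_le (hym : ∀ j, Measurable (y j)) (hind : iIndepFun y P)
    (hlaw : ∀ j, Measure.map (y j) P = μ.withDensity fun z => ENNReal.ofReal (q z))
    (hp0 : ∀ z, 0 ≤ p z) (hpm : Measurable p) (hpi : Integrable p μ) (hp1 : ∫ z, p z ∂μ = 1)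
    (hq0 : ∀ z, 0 < q z) (hqm : Measurable q) (hOm : Measurable O) {M : ℝ} (hM0 : 0 < M)
    (hM : ∀ z, p z / q z ≤ M) (u : ℝ) {δ : ℝ} (hδ : 0 ≤ δ) (n : ℕ) :
    P.real {ω | (n : ℝ) * δ / 2 ≤ ∑ i ∈ range n, p (y i ω) / q (y i ω)
        * ((Set.Iio u).indicator (1 : ℝ → ℝ) (O (y i ω))
          - Function.leftLim (cdf ((μ.withDensity fun z => ENNReal.ofReal (p z)).map O)) u)}
      ≤ Real.exp (-(n * δ ^ 2 / (8 * M ^ 2))) := by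
  haveI := isProbabilityMeasure_targetLaw (μ := μ) hp0 hpi hp1 hOm
  set F : ℝ := Function.leftLim (cdf ((μ.withDensity fun z => ENNReal.ofReal (p z)).map O)) u
    with hF
  have hF0 : 0 ≤ F := by
    rw [hF, leftLim_cdf_eq_real]
    exact measureReal_nonneg
  have hF1 : F ≤ 1 := by
    rw [hF, leftLim_cdf_eq_real]
    exact measureReal_le_one
  have hwm : Measurable fun z => p z / q z := hpm.div hqm
  have hgm : Measurable fun z => p z / q z * ((Set.Iio u).indicator (1 : ℝ → ℝ) (O z) - F) :=
    hwm.mul (((measurable_one.indicator measurableSet_Iio).comp hOm).sub measurable_const)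
  set W : ℕ → Ω → ℝ := fun i ω =>
    p (y i ω) / q (y i ω) * ((Set.Iio u).indicator (1 : ℝ → ℝ) (O (y i ω)) - F) with hW
  have hWm : ∀ i, AEMeasurable (W i) P := fun i => (hgm.comp (hym i)).aemeasurable
  have hWind : iIndepFun W P :=
    hind.comp (fun _ z => p z / q z * ((Set.Iio u).indicator (1 : ℝ → ℝ) (O z) - F)) fun _ => hgm
  have hWb : ∀ i, ∀ᵐ ω ∂P, W i ω ∈ Set.Icc (-M) M := fun i => ae_of_all _ fun ω => by
    have hw0 : 0 ≤ p (y i ω) / q (y i ω) := div_nonneg (hp0 _) (hq0 _).le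
    have hwM := hM (y i ω)
    have hf1 : (Set.Iio u).indicator (1 : ℝ → ℝ) (O (y i ω)) - F ≤ 1 := by
      linarith [indicator_one_le_one (Set.Iio u) (O (y i ω))]
    have hf0 : -1 ≤ (Set.Iio u).indicator (1 : ℝ → ℝ) (O (y i ω)) - F := by
      linarith [indicator_one_nonneg (Set.Iio u) (O (y i ω))]
    constructor
    · simp only [hW]
      nlinarith
    · simp only [hW]
      nlinarith
  have hWmean : ∀ i, ∫ ω, W i ω ∂P ≤ 0 := by
    intro i
    have e : ∫ ω, W i ω ∂P
        = ∫ ω, p (y i ω) / q (y i ω) * (Set.Iio u).indicator (1 : ℝ → ℝ) (O (y i ω)) ∂P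
          - F * ∫ ω, p (y i ω) / q (y i ω) ∂P := by
      rw [hW]
      simp only [mul_sub]
      rw [integral_sub, ← integral_const_mul]
      · congr 1
        refine integral_congr_ae (Eventually.of_forall fun ω => ?_)
        ring
      · refine Integrable.mono' (((CardConsistency.integrable_comp_stream_iff hym hlaw hwm i).2
          ((AllPairsVariance.integrable_withDensity_iff' (fun z => (hq0 z).le) hqm _).2
            (by simpa only [div_mul_cancel₀ _ (hq0 _).ne'] using hpi))).norm)
          ((hwm.mul ((measurable_one.indicator measurableSet_Iio).comp hOm)).comp
            (hym i)).aestronglyMeasurable (Eventually.of_forall fun ω => ?_)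
        rw [Real.norm_eq_abs, Real.norm_eq_abs, abs_mul]
        refine mul_le_of_le_one_right (abs_nonneg _) ?_
        rw [abs_of_nonneg (indicator_one_nonneg _ _)]
        exact indicator_one_le_one _ _
      · exact ((CardConsistency.integrable_comp_stream_iff hym hlaw hwm i).2
          ((AllPairsVariance.integrable_withDensity_iff' (fun z => (hq0 z).le) hqm _).2
            (by simpa only [div_mul_cancel₀ _ (hq0 _).ne'] using hpi))).mul_const F
    rw [e, integral_weight_stream hym hlaw hpm hp1 hq0 hqm i,
      integral_weight_indicator_stream hym hlaw hp0 hpm hq0 hqm hOm measurableSet_Iio i, hF,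
      leftLim_cdf_eq_real, mul_one, sub_self]
  have hH := Literature.Probability.Moments.measureReal_le_sum_le_exp_of_integral_le hWind hWm
    hWb hWmean (δ := δ / 2) (by positivity) (range n)
  rw [Finset.card_range] at hH
  have hsub : {ω | (n : ℝ) * δ / 2 ≤ ∑ i ∈ range n, p (y i ω) / q (y i ω)
        * ((Set.Iio u).indicator (1 : ℝ → ℝ) (O (y i ω)) - F)}
      ⊆ {ω | (n : ℝ) * (0 + δ / 2) ≤ ∑ i ∈ range n, W i ω} := by
    intro ω hω
    simp only [Set.mem_setOf_eq, hW] at hω ⊢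
    linarith
  refine (measureReal_mono hsub).trans (hH.trans (le_of_eq ?_))
  congr 1
  field_simp
  ring

end Hoeffding

end Summit.Ventures.LatticeQCDFlow.Scoring.GlivenkoCantelli

end
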